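import Literature.AlgebraicGeometry.FiniteFields.WeilNumberTraceForm
import HarnessLib

/-!
# Twisted trace forms `Tr(d · x · y†)` of a system of `q`-Weil numbers

Topic `Literature/AlgebraicGeometry/FiniteFields`; grouping namespace `WeilTraceForm` (continues
`WeilNumberTraceForm.lean`). Everything proved; one plumbing definition (`twistedTraceGram`), no
named facts.

Setting and source as in `WeilNumberTraceForm.lean`: J. S. Milne, *Abelian Varieties* (in
Cornell–Silverman 1986) [Milne1986AbelianVarieties], §17 Thm. 17.3 (p. 137: `Tr(α ∘ β†)` is positive
definite on `End⁰(A)`) and §19 Lemma 19.3 with its proof (pp. 145–146: on each factor of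
`ℚ(α) ⊗ ℝ` the involution `†` is the identity or complex conjugation, because `Tr(β† β) > 0`).

On the étale algebra `K = ℂ[T]/χ` (`χ = ∏ (T - α_k)`, distinct roots, `T† = q/T` under a
functional-equation structure) EVERY symmetric bilinear form `B` with `B(Tx, Ty) = q · B(x, y)` is
`B_d(x, y) = Tr(d · x · y†)` for a unique `†`-symmetric `d ∈ K` (the space of such forms has dimension
`n`); in root coordinates `d` is the weight vector `w_k = d(α_k)` and the Gram matrix of `B_d` in the
power basis is `twistedTraceGram w q α i j = Σ_k w_k α_kⁱ (q/α_k)ʲ` (`w = 1`: `traceGram`,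
`twistedTraceGram_one`). Results, for pairwise distinct roots and `q ≠ 0`:
* `twistedTraceGram_eq_conjTranspose_mul_diagonal_mul`: under RH (`ᾱ_k α_k = q`),
  `Gʷ = V̄ᴴ · diag(w) · V̄`, `V̄ = vandermonde (conj ∘ α)`;
* `posDef_twistedTraceGram_of_RH`: RH and all `w_k` positive reals ⟹ `Gʷ` positive definite;
* `weights_pos_of_posDef_twistedTraceGram_of_RH`: under RH, `Gʷ` positive definite ⟹ all `w_k`
  positive reals (`diag(w)` is congruent to `Gʷ` by the invertible `V̄⁻¹`);
* `IsFEPerm.conj_mul_self_eq_of_posDef_twistedTraceGram`: for roots stable under `a ↦ q/a` and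
  under conj, `Gʷ` positive definite ⟹ RH, for ANY weights — Milne's Lemma 19.3 for the form
  `Tr(d x y†)` (same Lagrange-idempotent witness as for `d = 1`);
* `IsFEPerm.posDef_twistedTraceGram_iff`: `Gʷ` positive definite ⟺ (RH) ∧ (`d` totally positive:
  every `w_k` a positive real).

So a finite-level similitude-invariant symmetric pairing on a squarefree `q`-Weil-type Frobenius
module is positive definite exactly when the characteristic polynomial satisfies the Riemann
hypothesis AND its twist `d` is totally positive; the second condition is void for the trace form
itself (`d = 1`).

## Deliberately NOT here
The identification of an arbitrary similitude-invariant symmetric form with some `B_d` (a counting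
argument on the `n`-dimensional solution space of `Fᵀ M F = q M`); everything listed as not covered in
`WeilNumberTraceForm.lean`.
-/

noncomputable section

namespace Literature.AlgebraicGeometry.FiniteFields

namespace WeilTraceForm

open Matrix Finset
open scoped ComplexOrder ComplexConjugate BigOperators

variable {n : ℕ}

/-- Under a functional-equation structure, `q / α_k = α_{σ k}` (local copy of the private lemma of
`WeilNumberTraceForm.lean`). [folklore] -/
private theorem IsFEPerm.div_eq' {q : ℂ} {α : Fin n → ℂ} {σ : Equiv.Perm (Fin n)}
    (h : IsFEPerm q α σ) (hq : q ≠ 0) (k : Fin n) : q / α k = α (σ k) := by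
  have hk : α k ≠ 0 := by
    intro hk
    have := h k
    rw [hk, mul_zero] at this
    exact hq this.symm
  rw [← h k, mul_div_assoc, div_self hk, mul_one]

/-! ## The twisted Gram matrix

On the algebra `ℂ[T]/χ` (distinct roots) every symmetric bilinear form `B` with `B(Tx, Ty) = q B(x,y)`
is `B_d(x, y) = Tr(d · x · y†)` for a unique `†`-symmetric `d`; in root coordinates `d` is the weight
vector `w_k = d(α_k)` and the Gram matrix in the power basis is `Σ_k w_k α_kⁱ (q/α_k)ʲ`. The lemma of
Milne §19 in this generality: `B_d` positive definite ⟹ Riemann hypothesis (whatever `d`); and under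
the Riemann hypothesis `B_d` is positive definite iff every weight `w_k = d(α_k)` is a positive real
("`d` totally positive") — for `d = 1` this is the previous section. -/

/-- The twisted trace Gram matrix with weights `w_k = d(α_k)`: `Gʷ i j = Σ_k w_k α_kⁱ (q/α_k)ʲ`, the
matrix of `(x, y) ↦ Tr(d · x · y†)` on `ℂ[T]/∏(T - α_k)` in the power basis.
[cite: Milne1986AbelianVarieties, §17 Thm. 17.3 (p. 137) and §19 Lemma 19.3, pp. 145–146] -/
def twistedTraceGram (w : Fin n → ℂ) (q : ℂ) (α : Fin n → ℂ) : Matrix (Fin n) (Fin n) ℂ :=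
  Matrix.of fun i j => ∑ k, w k * α k ^ (i : ℕ) * (q / α k) ^ (j : ℕ)

/-- Entries of the twisted trace Gram matrix. [folklore] -/
private theorem twistedTraceGram_apply (w : Fin n → ℂ) (q : ℂ) (α : Fin n → ℂ) (i j : Fin n) :
    twistedTraceGram w q α i j = ∑ k, w k * α k ^ (i : ℕ) * (q / α k) ^ (j : ℕ) := rfl

/-- Weights `w = 1` give back the trace Gram matrix. [cite: Milne1986AbelianVarieties, §19 Lemma 19.3, pp. 145–146] -/
theorem twistedTraceGram_one (q : ℂ) (α : Fin n → ℂ) :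
    twistedTraceGram (fun _ => 1) q α = traceGram q α := by
  ext i j
  rw [twistedTraceGram_apply, traceGram_apply]
  exact sum_congr rfl fun k _ => by rw [one_mul]

/-- Under RH, `Gʷ = V̄ᴴ · diag(w) · V̄` with `V̄ = vandermonde (conj ∘ α)`.
[cite: Milne1986AbelianVarieties, §19 Lemma 19.3 (proof), pp. 145–146] -/
theorem twistedTraceGram_eq_conjTranspose_mul_diagonal_mul {w : Fin n → ℂ} {q : ℂ} {α : Fin n → ℂ}
    (hq : q ≠ 0) (hRH : ∀ k, conj (α k) * α k = q) :
    twistedTraceGram w q α =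
      (vandermonde (fun k => conj (α k)))ᴴ * diagonal w * vandermonde (fun k => conj (α k)) := by
  ext i j
  rw [twistedTraceGram_apply, mul_apply]
  refine sum_congr rfl fun k _ => ?_
  rw [mul_apply, Fintype.sum_eq_single k (fun l hl => by rw [diagonal_apply_ne w hl, mul_zero]),
    diagonal_apply_eq, conjTranspose_apply, vandermonde_apply, vandermonde_apply, Complex.star_def,
    map_pow, Complex.conj_conj, div_eq_conj_of_RH hq (hRH k)]
  ring

/-- **RH with distinct roots and totally positive weights ⟹ `Tr(d x y†)` is positive definite.**
[cite: Milne1986AbelianVarieties, §17 Thm. 17.3 (p. 137) and §19 Lemma 19.3 (proof), pp. 145–146] -/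
theorem posDef_twistedTraceGram_of_RH {w : Fin n → ℂ} {q : ℂ} {α : Fin n → ℂ} (hq : q ≠ 0)
    (hRH : ∀ k, conj (α k) * α k = q) (hinj : Function.Injective α) (hw : ∀ k, 0 < w k) :
    (twistedTraceGram w q α).PosDef := by
  classical
  rw [twistedTraceGram_eq_conjTranspose_mul_diagonal_mul hq hRH]
  refine (PosDef.diagonal hw).conjTranspose_mul_mul_same ?_
  rw [mulVec_injective_iff_isUnit, isUnit_iff_isUnit_det, isUnit_iff_ne_zero,
    det_vandermonde_ne_zero_iff]
  exact fun k l hkl => hinj ((starRingEnd ℂ).injective (by simpa using hkl))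

/-- **Under RH with distinct roots, `Tr(d x y†)` positive definite ⟹ every weight `d(α_k)` is a
positive real** (`d` totally positive). [cite: Milne1986AbelianVarieties, §19 Lemma 19.3 (proof), pp. 145–146] -/
theorem weights_pos_of_posDef_twistedTraceGram_of_RH {w : Fin n → ℂ} {q : ℂ} {α : Fin n → ℂ}
    (hq : q ≠ 0) (hRH : ∀ k, conj (α k) * α k = q) (hinj : Function.Injective α)
    (hG : (twistedTraceGram w q α).PosDef) (k : Fin n) : 0 < w k := by
  classical
  set V : Matrix (Fin n) (Fin n) ℂ := vandermonde (fun k => conj (α k)) with hV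
  have hVdet : IsUnit V.det := by
    rw [isUnit_iff_ne_zero, hV, det_vandermonde_ne_zero_iff]
    exact fun k l hkl => hinj ((starRingEnd ℂ).injective (by simpa using hkl))
  -- `diag(w) = (V⁻¹)ᴴ Gʷ V⁻¹`, a congruent of the positive definite `Gʷ` by an invertible matrix
  have h1 : V * V⁻¹ = 1 := mul_nonsing_inv _ hVdet
  have h1' : V⁻¹ᴴ * Vᴴ = 1 := by rw [← conjTranspose_mul, h1, conjTranspose_one]
  have hD : diagonal w = (V⁻¹)ᴴ * twistedTraceGram w q α * V⁻¹ := by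
    rw [twistedTraceGram_eq_conjTranspose_mul_diagonal_mul hq hRH, ← hV]
    calc diagonal w = (V⁻¹ᴴ * Vᴴ) * diagonal w * (V * V⁻¹) := by
            rw [h1', h1, Matrix.one_mul, Matrix.mul_one]
      _ = V⁻¹ᴴ * (Vᴴ * diagonal w * V) * V⁻¹ := by simp only [Matrix.mul_assoc]
  have hP : (diagonal w).PosDef := by
    rw [hD]
    refine hG.conjTranspose_mul_mul_same ?_
    rw [mulVec_injective_iff_isUnit, isUnit_iff_isUnit_det]
    exact isUnit_nonsing_inv_det _ hVdet
  exact (posDef_diagonal_iff.1 hP) k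


/-- Under a functional-equation structure, `Gʷ i j = Σ_k w_k α_kⁱ α_{σ k}ʲ`. [folklore] -/
private theorem IsFEPerm.twistedTraceGram_apply {w : Fin n → ℂ} {q : ℂ} {α : Fin n → ℂ}
    {σ : Equiv.Perm (Fin n)} (h : IsFEPerm q α σ) (hq : q ≠ 0) (i j : Fin n) :
    twistedTraceGram w q α i j = ∑ k, w k * α k ^ (i : ℕ) * α (σ k) ^ (j : ℕ) := by
  rw [WeilTraceForm.twistedTraceGram_apply]
  exact sum_congr rfl fun k _ => by rw [h.div_eq' hq]

/-- Under a functional-equation structure, `Gʷ x = Vᵀ (k ↦ w_k (V x)_{σ k})`, `V = vandermonde α`.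
[folklore] -/
private theorem IsFEPerm.twistedTraceGram_mulVec {w : Fin n → ℂ} {q : ℂ} {α : Fin n → ℂ}
    {σ : Equiv.Perm (Fin n)} (h : IsFEPerm q α σ) (hq : q ≠ 0) (x : Fin n → ℂ) :
    twistedTraceGram w q α *ᵥ x =
      (vandermonde α)ᵀ *ᵥ fun k => w k * (vandermonde α *ᵥ x) (σ k) := by
  ext i
  simp only [mulVec, dotProduct, transpose_apply, vandermonde_apply, h.twistedTraceGram_apply hq,
    sum_mul, mul_sum]
  rw [sum_comm]
  exact sum_congr rfl fun k _ => sum_congr rfl fun j _ => by ring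

/-- **`Tr(d x y†)` positive definite ⟹ Riemann hypothesis, for ANY weights `d`.** Pairwise distinct
roots stable under `a ↦ q/a` and under complex conjugation, `q ≠ 0`: if `Gʷ` is positive definite
then `ᾱ_k α_k = q` for every `k` (the witness is the same Lagrange idempotent as for `d = 1`).
[cite: Milne1986AbelianVarieties, §19 Lemma 19.3 (proof), pp. 145–146] -/
theorem IsFEPerm.conj_mul_self_eq_of_posDef_twistedTraceGram {w : Fin n → ℂ} {q : ℂ}
    {α : Fin n → ℂ} {σ : Equiv.Perm (Fin n)} (h : IsFEPerm q α σ) (hq : q ≠ 0)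
    (hinj : Function.Injective α) (hconj : ∀ k, ∃ l, α l = conj (α k))
    (hG : (twistedTraceGram w q α).PosDef) (k : Fin n) : conj (α k) * α k = q := by
  classical
  obtain ⟨l, hl⟩ := hconj k
  suffices hls : l = σ k by rw [← hl, hls]; exact h k
  by_contra hls
  set V : Matrix (Fin n) (Fin n) ℂ := vandermonde α with hV
  have hVdet : IsUnit V.det := by
    rw [isUnit_iff_ne_zero, hV, det_vandermonde_ne_zero_iff]; exact hinj
  set e : Fin n → ℂ := Pi.single (σ k) 1 with he
  set x : Fin n → ℂ := V⁻¹ *ᵥ e with hx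
  have hVx : V *ᵥ x = e := by rw [hx, mulVec_mulVec, mul_nonsing_inv _ hVdet, one_mulVec]
  have hx0 : x ≠ 0 := by
    intro h0
    have := congr_fun hVx (σ k)
    rw [h0, mulVec_zero, he, Pi.zero_apply, Pi.single_eq_same] at this
    exact zero_ne_one this
  have hzero : star x ⬝ᵥ (twistedTraceGram w q α *ᵥ x) = 0 := by
    rw [h.twistedTraceGram_mulVec hq, ← hV, dotProduct_mulVec, vecMul_transpose, hVx]
    have hperm : (fun k' => w k' * e (σ k')) = Pi.single k (w k) := by
      ext k'
      simp only [he, Pi.single_apply, σ.injective.eq_iff, mul_ite, mul_one, mul_zero]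
      split_ifs with hk <;> simp [hk]
    rw [hperm, dotProduct_single]
    have hk' : (V *ᵥ star x) k = conj ((V *ᵥ x) l) := by
      simp only [hV, mulVec, dotProduct, vandermonde_apply, map_sum, map_mul, map_pow, hl,
        Complex.conj_conj, Pi.star_apply, Complex.star_def]
    rw [hk', hVx, he, Pi.single_eq_of_ne hls, map_zero, zero_mul]
  exact (lt_irrefl (0 : ℂ)) (hzero ▸ hG.dotProduct_mulVec_pos hx0)

/-- **Twisted trace forms detect RH and total positivity exactly.** For pairwise distinct roots
stable under `a ↦ q/a` and under complex conjugation (`q ≠ 0`) and any weights `w_k = d(α_k)`: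
`Tr(d x y†)` is positive definite iff (every root has `ᾱ_k α_k = q`) and (every weight is a
positive real). [cite: Milne1986AbelianVarieties, §17 Thm. 17.3 (p. 137) and §19 Lemma 19.3, pp. 145–146] -/
theorem IsFEPerm.posDef_twistedTraceGram_iff {w : Fin n → ℂ} {q : ℂ} {α : Fin n → ℂ}
    {σ : Equiv.Perm (Fin n)} (h : IsFEPerm q α σ) (hq : q ≠ 0) (hinj : Function.Injective α)
    (hconj : ∀ k, ∃ l, α l = conj (α k)) :
    (twistedTraceGram w q α).PosDef ↔ (∀ k, conj (α k) * α k = q) ∧ ∀ k, 0 < w k := by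
  constructor
  · intro hG
    have hRH := h.conj_mul_self_eq_of_posDef_twistedTraceGram hq hinj hconj hG
    exact ⟨hRH, weights_pos_of_posDef_twistedTraceGram_of_RH hq hRH hinj hG⟩
  · rintro ⟨hRH, hw⟩
    exact posDef_twistedTraceGram_of_RH hq hRH hinj hw

end WeilTraceForm

end Literature.AlgebraicGeometry.FiniteFields
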